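import Literature.AlgebraicGeometry.Motives.EtaleInverseImageComp
import Literature.AlgebraicGeometry.Motives.LinearCohomologyChangeOfRings
import HarnessLib

/-!
# Change of rings commutes with pull-back: `c_X ∘ f^* = λ ∘ f^* ∘ c_Y` on `R`-linear étale cohomology,
# and the reductions `ρ : Hⁿ(–_ét, S) → Hⁿ(–_ét, R)` of the `ℓ`-adic tower commute with `f^*`

For a morphism of schemes `f : X ⟶ Y` and a ring homomorphism `φ : S → R`, restriction of scalars
`res` (`ModuleSheafChangeOfRings.lean`) and the inverse images `π^*_S`, `π^*_R`
(`EtaleInverseImage.lean`) are related by the **base-change morphism**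
`λ_G : π^*_S (res G) ⟶ res (π^*_R G)` (`baseChangeRestrict`), adjoint to `res(η_G)` — note that
`π_* ∘ res = res ∘ π_*` on the nose. With it:

* `changeOfRingsMap_pullback` (**P2**): for `y ∈ Hⁿ_R(Y, G)`,
  `Hⁿ(λ_G)(f^*_S(c_Y y)) = c_X(f^*_R y)` in `Hⁿ_S(X, res π^*_R G)`; both sides are `δ`-morphisms
  out of `Hⁿ_R(Y, –)` (`ext_deltaMorphism`), and in degree `0` both send the unit section to
  `η_G(g(1))` (a computation with constant sections over the final object `Y ×_Y X` of `X_et`);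
* `reductionMap_etaleModCohomologyMap`: for `φ : S ↠ R = S/(a)`, `(a, b)` exact, the reduction of
  coefficients `ρ` (`LinearCohomologyChangeOfRings.lean`, a ring homomorphism) commutes with the
  pull-back: `ρ_X(f^* x) = f^*(ρ_Y x)` on `Hⁿ(–_ét, S) → Hⁿ(–_ét, R)` — so the transition maps of
  the `ℓ`-adic tower `(Hⁿ(–_ét, ℤ/ℓᵐ))ₘ` are natural in the scheme, and the tower is a functor.

## References

* J. S. Milne, *Étale cohomology* (reissue 2025; held copy): II Rem. 3.1 (d), III Rem. 1.6 (c),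
  III Ex. 2.25. [Milne2025]

## Design notes

* `λ` is only shown to be compatible with sections over `Y ×_Y X` (`baseChangeRestrict_section`);
  that it is an isomorphism is not needed.
* The final objects: `r_Y`, `ρ_Y` use `Y ∈ Y_et` (`isTerminalEtaleMkId Y`), `r_X`, `ρ_X` use
  `X ∈ X_et`; the degree-`0` comparison is made over `Y ×_Y X ∈ X_et`
  (`isTerminalEtaleBaseChangeObjMkId f`), restricting along the unique map `Y ×_Y X → X`.
-/

universe u

open CategoryTheory CategoryTheory.Limits AlgebraicGeometry Opposite CategoryTheory.Abelian

namespace Literature.AlgebraicGeometry.Motives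

variable {X Y : Scheme.{u}} (f : X ⟶ Y) {S R : Type u} [CommRing S] [CommRing R] (φ : S →+* R)

/-! ### The base-change morphism `λ : π^*_S (res G) → res (π^*_R G)` -/

section BaseChange

set_option backward.isDefEq.respectTransparency false in
/-- `π_* (res G) = res (π_* G)` on the nose (both are "precompose base change, postcompose
restriction of scalars"). [folklore] -/
theorem etalePushforward_obj_restrictScalarsSheaf (G : Sheaf X.smallEtaleTopology (ModuleCat.{u} R)) :
    (etalePushforward f (ModuleCat.{u} S)).obj ((restrictScalarsSheaf _ φ).obj G) =
      (restrictScalarsSheaf _ φ).obj ((etalePushforward f (ModuleCat.{u} R)).obj G) :=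
  rfl

set_option backward.isDefEq.respectTransparency false in
/-- **The base-change morphism `λ_G : π^*_S (res G) ⟶ res (π^*_R G)`**: the adjoint, for
`π^*_S ⊣ π_*`, of `res(η_G) : res G → res (π_* π^*_R G) = π_* (res π^*_R G)`. [folklore] -/
noncomputable def baseChangeRestrict (G : Sheaf Y.smallEtaleTopology (ModuleCat.{u} R)) :
    (etaleInverseImage f (ModuleCat.{u} S)).obj ((restrictScalarsSheaf _ φ).obj G) ⟶
      (restrictScalarsSheaf _ φ).obj ((etaleInverseImage f (ModuleCat.{u} R)).obj G) :=
  ((etaleInverseImageAdjunction f (ModuleCat.{u} S)).homEquiv _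
      ((restrictScalarsSheaf _ φ).obj ((etaleInverseImage f (ModuleCat.{u} R)).obj G))).symm
    ((restrictScalarsSheaf _ φ).map ((etaleInverseImageAdjunction f (ModuleCat.{u} R)).unit.app G))

set_option backward.isDefEq.respectTransparency false in
/-- The adjunction identity defining `λ`: `η^S_{res G} ≫ π_* λ_G = res(η^R_G)`. [folklore] -/
theorem unit_comp_map_baseChangeRestrict (G : Sheaf Y.smallEtaleTopology (ModuleCat.{u} R)) :
    (etaleInverseImageAdjunction f (ModuleCat.{u} S)).unit.app ((restrictScalarsSheaf _ φ).obj G) ≫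
        (etalePushforward f (ModuleCat.{u} S)).map (baseChangeRestrict f φ G) =
      (restrictScalarsSheaf _ φ).map ((etaleInverseImageAdjunction f (ModuleCat.{u} R)).unit.app G) := by
  have h := (etaleInverseImageAdjunction f (ModuleCat.{u} S)).homEquiv_unit
    (X := (restrictScalarsSheaf _ φ).obj G) (f := baseChangeRestrict f φ G)
  rw [← h, baseChangeRestrict, Equiv.apply_symm_apply]

set_option backward.isDefEq.respectTransparency false in
/-- **Sections of `λ`**: for `V ∈ Y_et`, `η^S_{res G}(V) ≫ λ_G(V ×_Y X) = η^R_G(V)` (as `S`-linear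
maps `G(V) → (π^*_R G)(V ×_Y X)`). [folklore] -/
theorem baseChangeRestrict_section (G : Sheaf Y.smallEtaleTopology (ModuleCat.{u} R)) (V : Y.Etale) :
    ((etaleInverseImageAdjunction f (ModuleCat.{u} S)).unit.app
          ((restrictScalarsSheaf _ φ).obj G)).hom.app (op V) ≫
        (baseChangeRestrict f φ G).hom.app (op ((etaleBaseChange f).obj V)) =
      (ModuleCat.restrictScalars.{u} φ).map
        (((etaleInverseImageAdjunction f (ModuleCat.{u} R)).unit.app G).hom.app (op V)) := by
  have h := Sheaf.congr_hom_app (unit_comp_map_baseChangeRestrict f φ G) (op V)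
  exact h

set_option backward.isDefEq.respectTransparency false in
/-- **Naturality of `λ`** in `G`. [folklore] -/
theorem baseChangeRestrict_naturality {G G' : Sheaf Y.smallEtaleTopology (ModuleCat.{u} R)}
    (ψ : G ⟶ G') :
    (etaleInverseImage f (ModuleCat.{u} S)).map ((restrictScalarsSheaf _ φ).map ψ) ≫
        baseChangeRestrict f φ G' =
      baseChangeRestrict f φ G ≫
        (restrictScalarsSheaf _ φ).map ((etaleInverseImage f (ModuleCat.{u} R)).map ψ) := by
  apply ((etaleInverseImageAdjunction f (ModuleCat.{u} S)).homEquiv _ _).injective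
  rw [Adjunction.homEquiv_naturality_left, Adjunction.homEquiv_naturality_right, baseChangeRestrict,
    baseChangeRestrict, Equiv.apply_symm_apply, Equiv.apply_symm_apply]
  change (restrictScalarsSheaf _ φ).map ψ ≫
      (restrictScalarsSheaf _ φ).map ((etaleInverseImageAdjunction f (ModuleCat.{u} R)).unit.app G') =
    (restrictScalarsSheaf _ φ).map ((etaleInverseImageAdjunction f (ModuleCat.{u} R)).unit.app G) ≫
      (restrictScalarsSheaf _ φ).map ((etalePushforward f (ModuleCat.{u} R)).map
        ((etaleInverseImage f (ModuleCat.{u} R)).map ψ))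
  rw [← Functor.map_comp, ← Functor.map_comp]
  exact congrArg _ ((etaleInverseImageAdjunction f (ModuleCat.{u} R)).unit.naturality ψ)

set_option backward.isDefEq.respectTransparency false in
/-- `λ` as a natural transformation `res ⋙ π^*_S ⟶ π^*_R ⋙ res`. [folklore] -/
noncomputable def baseChangeRestrictNatTrans :
    restrictScalarsSheaf _ φ ⋙ etaleInverseImage f (ModuleCat.{u} S) ⟶
      etaleInverseImage f (ModuleCat.{u} R) ⋙ restrictScalarsSheaf _ φ where
  app G := baseChangeRestrict f φ G
  naturality _ _ ψ := baseChangeRestrict_naturality f φ ψ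

end BaseChange

/-! ### The exact functors involved -/

section Instances

variable [HasSheafify Y.smallEtaleTopology (ModuleCat.{u} R)]

set_option backward.isDefEq.respectTransparency false in
/-- `π^*_R ⋙ res` is additive. [folklore] -/
instance etaleInverseImage_comp_restrictScalarsSheaf_additive :
    (etaleInverseImage f (ModuleCat.{u} R) ⋙ restrictScalarsSheaf X.smallEtaleTopology φ).Additive :=
  inferInstance

set_option backward.isDefEq.respectTransparency false in
/-- `π^*_R ⋙ res` is left exact. [folklore] -/
instance etaleInverseImage_comp_restrictScalarsSheaf_preservesFiniteLimits :
    PreservesFiniteLimits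
      (etaleInverseImage f (ModuleCat.{u} R) ⋙ restrictScalarsSheaf X.smallEtaleTopology φ) :=
  comp_preservesFiniteLimits _ _

set_option backward.isDefEq.respectTransparency false in
/-- `π^*_R ⋙ res` is right exact. [folklore] -/
instance etaleInverseImage_comp_restrictScalarsSheaf_preservesFiniteColimits :
    PreservesFiniteColimits
      (etaleInverseImage f (ModuleCat.{u} R) ⋙ restrictScalarsSheaf X.smallEtaleTopology φ) :=
  comp_preservesFiniteColimits _ _

set_option backward.isDefEq.respectTransparency false in
/-- `res ⋙ π^*_S` is additive. [folklore] -/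
instance restrictScalarsSheaf_comp_etaleInverseImage_additive :
    (restrictScalarsSheaf Y.smallEtaleTopology φ ⋙ etaleInverseImage f (ModuleCat.{u} S)).Additive :=
  inferInstance

set_option backward.isDefEq.respectTransparency false in
/-- `res ⋙ π^*_S` is left exact. [folklore] -/
instance restrictScalarsSheaf_comp_etaleInverseImage_preservesFiniteLimits :
    PreservesFiniteLimits
      (restrictScalarsSheaf Y.smallEtaleTopology φ ⋙ etaleInverseImage f (ModuleCat.{u} S)) :=
  comp_preservesFiniteLimits _ _

set_option backward.isDefEq.respectTransparency false in
/-- `res ⋙ π^*_S` is right exact. [folklore] -/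
instance restrictScalarsSheaf_comp_etaleInverseImage_preservesFiniteColimits :
    PreservesFiniteColimits
      (restrictScalarsSheaf Y.smallEtaleTopology φ ⋙ etaleInverseImage f (ModuleCat.{u} S)) :=
  comp_preservesFiniteColimits _ _

end Instances

/-! ### Degree `0`: the two composites agree on constant sections -/

section DegreeZero

set_option backward.isDefEq.respectTransparency false in
/-- What `ι⁻¹ : M_X → π^* M_Y` does to constant sections over `Y ×_Y X`:
`cs_X ≫ ι⁻¹ = cs_Y ≫ η` (the inverse form of the defining property of `ι`). [folklore] -/
theorem constantSection_comp_inverseImageConstantSheafIso_inv (T : Type u) [CommRing T]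
    (M : ModuleCat.{u} T) :
    constantSection X.smallEtaleTopology M ((etaleBaseChange f).obj (Scheme.Etale.mk (𝟙 Y))) ≫
        ((etaleInverseImageConstantSheafIso f (ModuleCat.{u} T) M).inv).hom.app
          (op ((etaleBaseChange f).obj (Scheme.Etale.mk (𝟙 Y)))) =
      constantSection Y.smallEtaleTopology M (Scheme.Etale.mk (𝟙 Y)) ≫
        ((etaleInverseImageAdjunction f (ModuleCat.{u} T)).unit.app
          ((constantSheaf Y.smallEtaleTopology (ModuleCat.{u} T)).obj M)).hom.app
            (op (Scheme.Etale.mk (𝟙 Y))) := by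
  have L := constantSection_comp_unit_comp_inverseImageConstantSheafIso_terminal f (ModuleCat.{u} T) M
  have hinv : ((etaleInverseImageConstantSheafIso f (ModuleCat.{u} T) M).hom).hom.app
        (op ((etaleBaseChange f).obj (Scheme.Etale.mk (𝟙 Y)))) ≫
      ((etaleInverseImageConstantSheafIso f (ModuleCat.{u} T) M).inv).hom.app
        (op ((etaleBaseChange f).obj (Scheme.Etale.mk (𝟙 Y)))) = 𝟙 _ :=
    Sheaf.congr_hom_app (etaleInverseImageConstantSheafIso f (ModuleCat.{u} T) M).hom_inv_id _
  rw [← L]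
  simp only [Category.assoc]
  rw [hinv]
  exact congrArg (fun z => constantSection Y.smallEtaleTopology M (Scheme.Etale.mk (𝟙 Y)) ≫ z)
    (Category.comp_id _)

set_option backward.isDefEq.respectTransparency false in
/-- The defining property of `r = changeOfRingsUnit` on the constant section over the chosen final
object: `cs(T) ≫ r_T = θ` (`θ(s) = s · u`). [folklore] -/
theorem constantSection_comp_changeOfRingsUnit {Z : Scheme.{u}} {T : Z.Etale} (hT : IsTerminal T) :
    constantSection Z.smallEtaleTopology (ModuleCat.of S S) T ≫
        (changeOfRingsUnit φ hT).hom.app (op T) =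
      changeOfRingsUnitHom φ hT := by
  have h := (constantSheafAdj Z.smallEtaleTopology (ModuleCat.{u} S) hT).homEquiv_unit
    (X := ModuleCat.of S S) (f := changeOfRingsUnit φ hT)
  rw [changeOfRingsUnit, Equiv.apply_symm_apply, constantSheafAdj_unit_app] at h
  exact h.symm

variable [HasSheafify Y.smallEtaleTopology (ModuleCat.{u} R)]
  [HasSheafify X.smallEtaleTopology (ModuleCat.{u} R)]

set_option backward.isDefEq.respectTransparency false in
/-- **Degree `0` of P2.** For `g : R_Y → G`, the two morphisms `S_X → res π^*_R G`
`ι_S⁻¹ ≫ π^*_S(r_Y ≫ res g) ≫ λ_G` and `r_X ≫ res(ι_R⁻¹ ≫ π^*_R g)` coincide: on the constant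
section `1` over `Y ×_Y X` both give `η_G(g(u_Y))`. [folklore] -/
theorem degreeZero_identity (G : Sheaf Y.smallEtaleTopology (ModuleCat.{u} R))
    (g : constantSheafSelf Y.smallEtaleTopology R ⟶ G) :
    (etaleInverseImageSelfIso f S).inv ≫
        (etaleInverseImage f (ModuleCat.{u} S)).map
          (changeOfRingsUnit φ (isTerminalEtaleMkId Y) ≫ (restrictScalarsSheaf _ φ).map g) ≫
        baseChangeRestrict f φ G =
      changeOfRingsUnit φ (isTerminalEtaleMkId X) ≫
        (restrictScalarsSheaf _ φ).map
          ((etaleInverseImageSelfIso f R).inv ≫ (etaleInverseImage f (ModuleCat.{u} R)).map g) := by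
  -- the final objects `Y ∈ Y_et`, `Y ×_Y X ∈ X_et`, `X ∈ X_et` are written out in full below
  apply constantSheaf_hom_ext (isTerminalEtaleBaseChangeObjMkId f)
  -- both sides are `S`-linear maps out of `S`: compare compositions with the constant section
  change constantSection X.smallEtaleTopology (ModuleCat.of S S) ((etaleBaseChange f).obj (Scheme.Etale.mk (𝟙 Y))) ≫
      (((etaleInverseImageSelfIso f S).inv).hom.app (op ((etaleBaseChange f).obj (Scheme.Etale.mk (𝟙 Y)))) ≫
        ((etaleInverseImage f (ModuleCat.{u} S)).map
          (changeOfRingsUnit φ (isTerminalEtaleMkId Y) ≫ (restrictScalarsSheaf _ φ).map g)).hom.app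
            (op ((etaleBaseChange f).obj (Scheme.Etale.mk (𝟙 Y)))) ≫
        (baseChangeRestrict f φ G).hom.app (op ((etaleBaseChange f).obj (Scheme.Etale.mk (𝟙 Y))))) =
    constantSection X.smallEtaleTopology (ModuleCat.of S S) ((etaleBaseChange f).obj (Scheme.Etale.mk (𝟙 Y))) ≫
      ((changeOfRingsUnit φ (isTerminalEtaleMkId X)).hom.app (op ((etaleBaseChange f).obj (Scheme.Etale.mk (𝟙 Y)))) ≫
        ((restrictScalarsSheaf _ φ).map
          ((etaleInverseImageSelfIso f R).inv ≫ (etaleInverseImage f (ModuleCat.{u} R)).map g)).hom.app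
            (op ((etaleBaseChange f).obj (Scheme.Etale.mk (𝟙 Y)))))
  -- LHS: `cs_X(((etaleBaseChange f).obj (Scheme.Etale.mk (𝟙 Y)))) ≫ ι_S⁻¹ = cs_Y(T) ≫ η^S`
  have a1 := constantSection_comp_inverseImageConstantSheafIso_inv f S (ModuleCat.of S S)
  -- unit naturality for `m = r_Y ≫ res g`
  have b1 : ((etaleInverseImageAdjunction f (ModuleCat.{u} S)).unit.app
        (constantSheafSelf Y.smallEtaleTopology S)).hom.app (op (Scheme.Etale.mk (𝟙 Y))) ≫
      ((etaleInverseImage f (ModuleCat.{u} S)).map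
        (changeOfRingsUnit φ (isTerminalEtaleMkId Y) ≫ (restrictScalarsSheaf _ φ).map g)).hom.app
          (op ((etaleBaseChange f).obj (Scheme.Etale.mk (𝟙 Y)))) =
      (changeOfRingsUnit φ (isTerminalEtaleMkId Y) ≫ (restrictScalarsSheaf _ φ).map g).hom.app
          (op (Scheme.Etale.mk (𝟙 Y))) ≫
        ((etaleInverseImageAdjunction f (ModuleCat.{u} S)).unit.app
          ((restrictScalarsSheaf _ φ).obj G)).hom.app (op (Scheme.Etale.mk (𝟙 Y))) :=
    (Sheaf.congr_hom_app ((etaleInverseImageAdjunction f (ModuleCat.{u} S)).unit.naturality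
      (changeOfRingsUnit φ (isTerminalEtaleMkId Y) ≫ (restrictScalarsSheaf _ φ).map g)) (op (Scheme.Etale.mk (𝟙 Y)))).symm
  have c1 := constantSection_comp_changeOfRingsUnit φ (isTerminalEtaleMkId Y)
  have e1 := baseChangeRestrict_section f φ G (Scheme.Etale.mk (𝟙 Y))
  -- RHS: `r_X` at `((etaleBaseChange f).obj (Scheme.Etale.mk (𝟙 Y)))` by restriction along `t : ((etaleBaseChange f).obj (Scheme.Etale.mk (𝟙 Y))) → X`
  have f1 : constantSection X.smallEtaleTopology (ModuleCat.of S S) ((etaleBaseChange f).obj (Scheme.Etale.mk (𝟙 Y))) ≫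
      (changeOfRingsUnit φ (isTerminalEtaleMkId X)).hom.app (op ((etaleBaseChange f).obj (Scheme.Etale.mk (𝟙 Y)))) =
      changeOfRingsUnitHom φ (isTerminalEtaleMkId X) ≫
        ((restrictScalarsSheaf _ φ).obj (constantSheafSelf X.smallEtaleTopology R)).obj.map ((isTerminalEtaleMkId X).from ((etaleBaseChange f).obj (Scheme.Etale.mk (𝟙 Y)))).op := by
    rw [← constantSection_comp_map X.smallEtaleTopology (ModuleCat.of S S) ((isTerminalEtaleMkId X).from ((etaleBaseChange f).obj (Scheme.Etale.mk (𝟙 Y)))), Category.assoc]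
    erw [(changeOfRingsUnit φ (isTerminalEtaleMkId X)).hom.naturality ((isTerminalEtaleMkId X).from ((etaleBaseChange f).obj (Scheme.Etale.mk (𝟙 Y)))).op]
    rw [← Category.assoc, constantSection_comp_changeOfRingsUnit]
  have a2 := constantSection_comp_inverseImageConstantSheafIso_inv f R (ModuleCat.of R R)
  have b2 : ((etaleInverseImageAdjunction f (ModuleCat.{u} R)).unit.app
        (constantSheafSelf Y.smallEtaleTopology R)).hom.app (op (Scheme.Etale.mk (𝟙 Y))) ≫
      ((etaleInverseImage f (ModuleCat.{u} R)).map g).hom.app (op ((etaleBaseChange f).obj (Scheme.Etale.mk (𝟙 Y)))) =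
      g.hom.app (op (Scheme.Etale.mk (𝟙 Y))) ≫
        ((etaleInverseImageAdjunction f (ModuleCat.{u} R)).unit.app G).hom.app (op (Scheme.Etale.mk (𝟙 Y))) :=
    (Sheaf.congr_hom_app ((etaleInverseImageAdjunction f (ModuleCat.{u} R)).unit.naturality g)
      (op (Scheme.Etale.mk (𝟙 Y)))).symm
  -- reduce to the values at `1 ∈ S`, in applied ("elementwise") normal form
  apply ModuleCat.hom_ext
  apply LinearMap.ext_ring
  have a1e := congrArg (fun ψ => (ModuleCat.Hom.hom ψ) (1 : S)) a1
  have b1e := fun z => congrArg (fun ψ => (ModuleCat.Hom.hom ψ) z) b1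
  have c1e := congrArg (fun ψ => (ModuleCat.Hom.hom ψ) (1 : S)) c1
  have e1e := fun z => congrArg (fun ψ => (ModuleCat.Hom.hom ψ) z) e1
  have f1e := congrArg (fun ψ => (ModuleCat.Hom.hom ψ) (1 : S)) f1
  have a2e := congrArg (fun ψ => (ModuleCat.Hom.hom ψ) (1 : R)) a2
  have b2e := fun z => congrArg (fun ψ => (ModuleCat.Hom.hom ψ) z) b2
  have u1 : (((restrictScalarsSheaf _ φ).obj (constantSheafSelf X.smallEtaleTopology R)).obj.map ((isTerminalEtaleMkId X).from ((etaleBaseChange f).obj (Scheme.Etale.mk (𝟙 Y)))).op).hom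
      ((changeOfRingsUnitHom φ (isTerminalEtaleMkId X)).hom 1) =
      (constantSection X.smallEtaleTopology (ModuleCat.of R R) ((etaleBaseChange f).obj (Scheme.Etale.mk (𝟙 Y)))).hom (1 : R) := by
    have := congrArg (fun ψ => (ModuleCat.Hom.hom ψ) (1 : R))
      (constantSection_comp_map X.smallEtaleTopology (ModuleCat.of R R) ((isTerminalEtaleMkId X).from ((etaleBaseChange f).obj (Scheme.Etale.mk (𝟙 Y)))))
    simp only [ModuleCat.hom_comp, LinearMap.comp_apply] at this
    rw [← this]
    change (((constantSheaf X.smallEtaleTopology (ModuleCat.{u} R)).obj (ModuleCat.of R R)).obj.map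
        ((isTerminalEtaleMkId X).from ((etaleBaseChange f).obj (Scheme.Etale.mk (𝟙 Y)))).op).hom ((1 : S) • unitSection φ (isTerminalEtaleMkId X)) = _
    rw [one_smul, unitSection, constantSheafAdj_unit_app]
    rfl
  have cu : (changeOfRingsUnitHom φ (isTerminalEtaleMkId Y)).hom (1 : S) =
      (constantSection Y.smallEtaleTopology (ModuleCat.of R R) (Scheme.Etale.mk (𝟙 Y))).hom (1 : R) := by
    change (1 : S) • unitSection φ (isTerminalEtaleMkId Y) = _
    rw [one_smul, unitSection, constantSheafAdj_unit_app]
    rfl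
  simp only [ObjectProperty.FullSubcategory.comp_hom, NatTrans.comp_app, ModuleCat.hom_comp,
    LinearMap.comp_apply] at a1e b1e c1e e1e f1e a2e b2e ⊢
  rw [a1e]
  erw [b1e, e1e, c1e, cu, f1e, u1]
  -- unwrap restriction of scalars (it does not change the underlying maps)
  simp only [Functor.map_comp, ObjectProperty.FullSubcategory.comp_hom, NatTrans.comp_app,
    ModuleCat.hom_comp, LinearMap.comp_apply, restrictScalarsSheaf_map_hom_app]
  erw [a2e, b2e]
  rfl

end DegreeZero

/-! ### P2: change of rings commutes with pull-back -/

section P2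

variable [HasSheafify Y.smallEtaleTopology (ModuleCat.{u} R)]
  [HasSheafify X.smallEtaleTopology (ModuleCat.{u} R)]

set_option maxHeartbeats 800000 in
set_option backward.isDefEq.respectTransparency false in
/-- **Change of rings commutes with pull-back (P2)**: for `y ∈ Hⁿ_R(Y, G)`,
`Hⁿ(λ_G)(f^*_S(c_Y(y))) = c_X(f^*_R(y))` in `Hⁿ_S(X, res π^*_R G)`. Both sides are `δ`-morphisms out
of `Hⁿ_R(Y, –)` into `Hⁿ_S(X, (π^*_R ⋙ res) –)` (for the left side, `λ` induces morphisms of the short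
exact sequences, Mathlib `extClass_naturality`), equal in degree `0` by `degreeZero_identity`;
`ext_deltaMorphism`. [cite: Milne2025, III Remark 1.6 (c)] -/
theorem changeOfRingsMap_pullback (G : Sheaf Y.smallEtaleTopology (ModuleCat.{u} R)) (n : ℕ)
    (y : linearCohomology R G n) :
    linearCohomology.map (baseChangeRestrict f φ G) n
        (linearCohomologyPullback f S _ n (changeOfRingsMap φ (isTerminalEtaleMkId Y) G n y)) =
      changeOfRingsMap φ (isTerminalEtaleMkId X) _ n (linearCohomologyPullback f R G n y) := by
  have key := ext_deltaMorphism
    (etaleInverseImage f (ModuleCat.{u} R) ⋙ restrictScalarsSheaf X.smallEtaleTopology φ)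
    (A := constantSheafSelf Y.smallEtaleTopology R) (B := constantSheafSelf X.smallEtaleTopology S)
    (fun G n y => linearCohomology.map (baseChangeRestrict f φ G) n
      (linearCohomologyPullback f S _ n (changeOfRingsMap φ (isTerminalEtaleMkId Y) G n y)))
    (fun G n y => changeOfRingsMap φ (isTerminalEtaleMkId X) _ n (linearCohomologyPullback f R G n y))
    ?_ ?_ ?_
  · exact congrFun (congrFun (congrFun key G) n) y
  · intro T hT n x
    change linearCohomology.map (baseChangeRestrict f φ T.X₁) (n + 1)
        (linearCohomologyPullback f S _ (n + 1)
          (changeOfRingsMap φ (isTerminalEtaleMkId Y) T.X₁ (n + 1)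
            (linearCohomology.delta hT n x))) =
      (linearCohomology.map (baseChangeRestrict f φ T.X₃) n
        (linearCohomologyPullback f S _ n
          (changeOfRingsMap φ (isTerminalEtaleMkId Y) T.X₃ n x))).comp
        (hT.map_of_exact (etaleInverseImage f (ModuleCat.{u} R) ⋙
          restrictScalarsSheaf X.smallEtaleTopology φ)).extClass rfl
    have nat := ((hT.map_of_exact (restrictScalarsSheaf Y.smallEtaleTopology φ)).map_of_exact
        (etaleInverseImage f (ModuleCat.{u} S))).extClass_naturality
      (hT.map_of_exact (etaleInverseImage f (ModuleCat.{u} R) ⋙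
        restrictScalarsSheaf X.smallEtaleTopology φ))
      (T.mapNatTrans (baseChangeRestrictNatTrans f φ))
    erw [changeOfRingsMap_delta φ (isTerminalEtaleMkId Y) hT n x,
      linearCohomologyPullback_delta f S (hT.map_of_exact (restrictScalarsSheaf _ φ)) n]
    rw [linearCohomology.map_apply, linearCohomology.delta_apply, Ext.comp_assoc_of_third_deg_zero]
    erw [nat]
    rw [← Ext.comp_assoc_of_second_deg_zero]
    rfl
  · intro T hT n x
    change changeOfRingsMap φ (isTerminalEtaleMkId X) _ (n + 1)
        (linearCohomologyPullback f R _ (n + 1) (linearCohomology.delta hT n x)) = _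
    erw [linearCohomologyPullback_delta f R hT n x,
      changeOfRingsMap_delta φ (isTerminalEtaleMkId X) (hT.map_of_exact (etaleInverseImage f _)) n]
    rfl
  · intro G x
    obtain ⟨g, rfl⟩ := (Ext.mk₀_bijective _ _).2 x
    change linearCohomology.map (baseChangeRestrict f φ G) 0
        (linearCohomologyPullback f S _ 0 (changeOfRingsMap φ (isTerminalEtaleMkId Y) G 0 (Ext.mk₀ g))) =
      changeOfRingsMap φ (isTerminalEtaleMkId X) _ 0 (linearCohomologyPullback f R G 0 (Ext.mk₀ g))
    rw [changeOfRingsMap_mk₀, linearCohomologyPullback_apply, Ext.mapExactFunctor_mk₀,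
      Ext.mk₀_comp_mk₀, linearCohomology.map_apply, Ext.mk₀_comp_mk₀, linearCohomologyPullback_apply,
      Ext.mapExactFunctor_mk₀, Ext.mk₀_comp_mk₀, changeOfRingsMap_mk₀, Category.assoc]
    exact congrArg Ext.mk₀ (degreeZero_identity f φ G g)

end P2

/-! ### The reductions of coefficients commute with pull-back -/

section Reduction

set_option backward.isDefEq.respectTransparency false in
/-- The sheaf-level identity behind the naturality of the reductions:
`ι_S ≫ r_X = π^*_S(r_Y) ≫ λ_{R_Y} ≫ res(ι_R)` as morphisms `π^*_S S_Y → res R_X`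
(`degreeZero_identity` with `g = 𝟙`). [folklore] -/
theorem inverseImageSelfIso_hom_comp_changeOfRingsUnit :
    (etaleInverseImageSelfIso f S).hom ≫ changeOfRingsUnit φ (isTerminalEtaleMkId X) =
      (etaleInverseImage f (ModuleCat.{u} S)).map (changeOfRingsUnit φ (isTerminalEtaleMkId Y)) ≫
        baseChangeRestrict f φ (constantSheafSelf Y.smallEtaleTopology R) ≫
        (restrictScalarsSheaf _ φ).map (etaleInverseImageSelfIso f R).hom := by
  have Q := degreeZero_identity f φ (constantSheafSelf Y.smallEtaleTopology R) (𝟙 _)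
  rw [CategoryTheory.Functor.map_id, Category.comp_id, CategoryTheory.Functor.map_id,
    Category.comp_id] at Q
  rw [← cancel_epi (etaleInverseImageSelfIso f S).inv, Iso.inv_hom_id_assoc,
    ← cancel_mono ((restrictScalarsSheaf X.smallEtaleTopology φ).map (etaleInverseImageSelfIso f R).inv),
    ← Q]
  simp only [Category.assoc]
  rw [← Functor.map_comp, Iso.hom_inv_id, CategoryTheory.Functor.map_id, Category.comp_id]

variable [IsGrothendieckAbelian.{u} (Sheaf Y.smallEtaleTopology (ModuleCat.{u} S))]
  [IsGrothendieckAbelian.{u} (Sheaf Y.smallEtaleTopology (ModuleCat.{u} R))]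
  [IsGrothendieckAbelian.{u} (Sheaf X.smallEtaleTopology (ModuleCat.{u} S))]
  [IsGrothendieckAbelian.{u} (Sheaf X.smallEtaleTopology (ModuleCat.{u} R))]
variable (hφ : Function.Surjective φ) {a b : S} (hker : RingHom.ker φ = Ideal.span {a})
  (hab : a * b = 0) (ha : ∀ s : S, s * a = 0 → ∃ t, s = t * b)
  (hb : ∀ s : S, s * b = 0 → ∃ t, s = t * a)

set_option backward.isDefEq.respectTransparency false in
/-- **The reductions of coefficients commute with the pull-back**: for `φ : S ↠ R = S/(a)` and an
exact pair `(a, b)`, `ρ_X(f^* x) = f^*(ρ_Y x)` for `x ∈ Hⁿ(Y_ét, S)` — the transition maps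
`Hⁿ(–_ét, ℤ/ℓᵐ⁺¹) → Hⁿ(–_ét, ℤ/ℓᵐ)` of the `ℓ`-adic tower are natural in the scheme (Milne III 1.6 (c)
with III Ex. 2.25). Proof: injectivity of `c_X`, `c(ρ x) = Hⁿ(r)(x)`, P2 and
`inverseImageSelfIso_hom_comp_changeOfRingsUnit`. [cite: Milne2025, III Remark 1.6 (c)] -/
theorem reductionMap_etaleModCohomologyMap (n : ℕ) (x : etaleModCohomology Y S n) :
    reductionMap φ (isTerminalEtaleMkId X) hφ hker hab ha hb n (etaleModCohomologyMap f S n x) =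
      etaleModCohomologyMap f R n
        (reductionMap φ (isTerminalEtaleMkId Y) hφ hker hab ha hb n x) := by
  apply (bijective_changeOfRingsMap φ (isTerminalEtaleMkId X) hφ hker hab ha hb n _).1
  rw [changeOfRingsMap_reductionMap, linearCohomologyMap_apply, linearCohomologyMap_apply,
    changeOfRingsMap_map, ← changeOfRingsMap_pullback, changeOfRingsMap_reductionMap,
    linearCohomologyPullback_map, ← linearCohomology.map_comp, ← linearCohomology.map_comp,
    ← linearCohomology.map_comp]
  exact congrArg (fun ψ => linearCohomology.map ψ n (linearCohomologyPullback f S _ n x))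
    (inverseImageSelfIso_hom_comp_changeOfRingsUnit f φ)

end Reduction

end Literature.AlgebraicGeometry.Motives
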